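import Mathlib
import Summits.SmoothPoincare4.SmoothPoincare4.Theses.SullivanDual
import Summits.SmoothPoincare4.SmoothPoincare4.Theorems.SullivanDualAdmissibleJExists
import Literature.Geometry.Symplectic.JHolomorphicMap
import HarnessLib

/-!
# Crux `HyperbolicEnd` (stmt-SmoothPoincare4-7825), line `Sketch` — the hyperbolic pair of the
# STANDARD sphere (lead's helper toward `stub_hyperbolicPair`)

For a punctured `4`-manifold `M ∖ {p}` carrying a diffeomorphism `Φ : M ∖ {p} ≃ₘ ℝ⁴` which agrees
with the inverted recentred chart `ι ∘ (e − e p)` near `p`, the pulled-back structure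
`J = (dΦ)⁻¹ J₀ dΦ` together with the pulled-back Bergman-type density
`F_x(v) = ‖dΦ_x v‖² / (R² − ‖Φ x‖²)` (`R` larger than `sup ‖Φ‖` on the compact core) is a
HYPERBOLIC PAIR in the sense of `stub_hyperbolicPair` of the skeleton `Lines/Sketch.lean`, GIVEN the
flat model certificate `stub_modelPair` (the statement `ModelPair` below, taken as a hypothesis):
along every local `J`-holomorphic map `f` into the core, `g = Φ ∘ f` is `J₀`-holomorphic into the
ball `B_R`, and the density of `f` for `F` IS the model density of `g`. Consequently (Palais' chart
form, proved in the tree) the conclusion of `stub_hyperbolicPair` holds for every homotopy `4`-sphere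
diffeomorphic to `S⁴` — the standard case of the hardest stub, and the statement that the curvature
certificate interface of the line is consistent.
-/

noncomputable section

-- the prescribed crux namespace repeats the component `SmoothPoincare4`
set_option linter.dupNamespace false

open scoped Manifold ContDiff Topology
open Laplacian Set Filter Function ContinuousLinearMap
open Literature.Geometry.Symplectic Literature.Topology.FourManifolds
open Summit.SmoothPoincare4.SmoothPoincare4.Theorems.SullivanDual

namespace Summit.SmoothPoincare4.SmoothPoincare4.Cruxes.HyperbolicEnd.Sketch

variable {M : Type*} [TopologicalSpace M] [T2Space M] [CompactSpace M]
  [ChartedSpace (EuclideanSpace ℝ (Fin 4)) M] [IsManifold (𝓡 4) ∞ M]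

omit [IsManifold (𝓡 4) ∞ M] in
/-- The core `{x ≠ p | x ∉ B_ε'}` of a compact punctured `4`-manifold is compact (in `M ∖ {p}`):
it is the trace of the closed set `M ∖ (e.source ∩ e⁻¹ B(e p, ε'))`, which misses `p`. -/
theorem isCompact_setOf_not_inPuncturedChartBall (p : M) {ε' : ℝ} (hε' : 0 < ε') :
    IsCompact {x : punctured p | ¬ InPuncturedChartBall p ε' x} := by
  set C : Set M := ((chartAt (EuclideanSpace ℝ (Fin 4)) p).source ∩
      (extChartAt (𝓡 4) p) ⁻¹' Metric.ball (extChartAt (𝓡 4) p p) ε')ᶜ with hC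
  have hCclosed : IsClosed C := by
    rw [hC, isClosed_compl_iff]
    have h := (continuousOn_extChartAt (I := 𝓡 4) p).isOpen_inter_preimage
      (isOpen_extChartAt_source (I := 𝓡 4) p) (Metric.isOpen_ball (x := extChartAt (𝓡 4) p p)
        (ε := ε'))
    rwa [extChartAt_source] at h
  have hCcpt : IsCompact C := hCclosed.isCompact
  have hpre : {x : punctured p | ¬ InPuncturedChartBall p ε' x} = Subtype.val ⁻¹' C := by
    ext x
    simp only [mem_setOf_eq, InPuncturedChartBall, mem_preimage, hC, mem_compl_iff, mem_inter_iff,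
      not_and]
  rw [hpre]
  refine Topology.IsInducing.subtypeVal.isCompact_iff.mpr ?_
  have himage : Subtype.val '' (Subtype.val ⁻¹' C : Set (punctured p)) = C := by
    rw [image_preimage_eq_inter_range, Subtype.range_coe_subtype]
    refine inter_eq_left.mpr fun x hx => ?_
    show x ∈ (punctured p : Set M)
    rw [SetLike.mem_coe, mem_punctured]
    rintro rfl
    exact hx ⟨mem_chart_source _ x, Metric.mem_ball_self hε'⟩
  convert hCcpt using 1
  exact himage

/-- **The hyperbolic pair of a punctured manifold diffeomorphic to `ℝ⁴` compatibly with the end.**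
Given the flat model certificate (`stub_modelPair` of the skeleton, hypothesis `hM`), a compact
`4`-manifold `M`, `p ∈ M` and a diffeomorphism `Φ : M ∖ {p} ≃ₘ ℝ⁴` agreeing with the inverted
recentred chart near `p`, the conclusion of `stub_hyperbolicPair` holds at `(M, p)` with
`J = (dΦ)⁻¹ J₀ dΦ`, `c = 2`, `F_x(v) = ‖dΦ_x v‖²/(R² - ‖Φ x‖²)` where `R` exceeds `‖Φ‖` on the
compact core: along a local `J`-holomorphic `f` into the core, `g = Φ ∘ f` is `J₀`-holomorphic
into `B_R` (`dΦ ∘ J = J₀ ∘ dΦ`) and the `F`-density of `f` equals the model density of `g` on the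
open set, so `hM` transfers (`ContDiffOn.congr`, `laplacian_congr_nhds`,
`Filter.EventuallyEq.fderiv_eq`). -/
theorem hyperbolicPair_of_diffeomorph
    (hM : (∀ (R : ℝ) (U : Set ℂ) (g : ℂ → EuclideanSpace ℝ (Fin 4)), 0 < R → IsOpen U →
      ContDiffOn ℝ ∞ g U →
      (∀ z ∈ U, ∀ ζ : ℂ, fderiv ℝ g z (Complex.I * ζ) = stdComplexStructure (fderiv ℝ g z ζ)) →
      (∀ z ∈ U, ‖g z‖ < R) →
      ContDiffOn ℝ 2 (fun z => ‖fderiv ℝ g z 1‖ ^ 2 / (R ^ 2 - ‖g z‖ ^ 2)) U ∧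
      ∀ z ∈ U, 2 * 2 * (‖fderiv ℝ g z 1‖ ^ 2 / (R ^ 2 - ‖g z‖ ^ 2)) ^ 3 ≤
        ‖fderiv ℝ g z 1‖ ^ 2 / (R ^ 2 - ‖g z‖ ^ 2) *
            (Δ (fun w => ‖fderiv ℝ g w 1‖ ^ 2 / (R ^ 2 - ‖g w‖ ^ 2))) z -
          ((fderiv ℝ (fun w => ‖fderiv ℝ g w 1‖ ^ 2 / (R ^ 2 - ‖g w‖ ^ 2)) z 1) ^ 2 +
            (fderiv ℝ (fun w => ‖fderiv ℝ g w 1‖ ^ 2 / (R ^ 2 - ‖g w‖ ^ 2)) z Complex.I) ^ 2)))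
    (p : M) (Φ : (punctured p) ≃ₘ⟮𝓡 4, 𝓡 4⟯ EuclideanSpace ℝ (Fin 4))
    (hagree : AgreesWithInvertedChartNear p Φ) :
    ∃ (J : ∀ x : ↥(punctured p), TangentSpace (𝓡 4) x →L[ℝ] TangentSpace (𝓡 4) x) (ε' c : ℝ)
      (F : ∀ x : ↥(punctured p), TangentSpace (𝓡 4) x → ℝ),
      0 < ε' ∧ Metric.closedBall (extChartAt (𝓡 4) p p) ε' ⊆ (extChartAt (𝓡 4) p).target ∧
      (∀ (x : ↥(punctured p)) (v : TangentSpace (𝓡 4) x), J x (J x v) = -v) ∧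
      (∀ x₀ : ↥(punctured p), ContMDiffAt (𝓡 4)
        𝓘(ℝ, EuclideanSpace ℝ (Fin 4) →L[ℝ] EuclideanSpace ℝ (Fin 4)) ∞
        (inTangentCoordinates (𝓡 4) (𝓡 4) (id : ↥(punctured p) → ↥(punctured p)) id
          (fun x => J x) x₀) x₀) ∧
      (∀ x : ↥(punctured p), InPuncturedChartBall p ε' x →
        ∀ (v : TangentSpace (𝓡 4) x) (b : EuclideanSpace ℝ (Fin 4)),
          inner ℝ (fderiv ℝ inversion (extChartAt (𝓡 4) p x.1 - extChartAt (𝓡 4) p p)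
            (mfderiv (𝓡 4) 𝓘(ℝ, EuclideanSpace ℝ (Fin 4))
              (fun z : ↥(punctured p) => extChartAt (𝓡 4) p z.1) x (J x v))) b =
          stdSymplecticForm (fderiv ℝ inversion (extChartAt (𝓡 4) p x.1 - extChartAt (𝓡 4) p p)
            (mfderiv (𝓡 4) 𝓘(ℝ, EuclideanSpace ℝ (Fin 4))
              (fun z : ↥(punctured p) => extChartAt (𝓡 4) p z.1) x v)) b) ∧
      0 < c ∧
      (∀ x : ↥(punctured p), ¬ InPuncturedChartBall p ε' x →
        ∀ v : TangentSpace (𝓡 4) x, 0 ≤ F x v ∧ (F x v = 0 → v = 0)) ∧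
      (∀ (U : Set ℂ) (f : ℂ → ↥(punctured p)), IsOpen U →
        ContMDiffOn 𝓘(ℝ, ℂ) (𝓡 4) ∞ f U →
        (∀ z ∈ U, ∀ ζ : ℂ, mfderiv 𝓘(ℝ, ℂ) (𝓡 4) f z (Complex.I * ζ : ℂ) =
          J (f z) (mfderiv 𝓘(ℝ, ℂ) (𝓡 4) f z (ζ : ℂ))) →
        (∀ z ∈ U, ¬ InPuncturedChartBall p ε' (f z)) →
        ContDiffOn ℝ 2 (fun z => F (f z) (mfderiv 𝓘(ℝ, ℂ) (𝓡 4) f z (1 : ℂ))) U ∧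
        ∀ z ∈ U, 2 * c * (F (f z) (mfderiv 𝓘(ℝ, ℂ) (𝓡 4) f z (1 : ℂ))) ^ 3 ≤
          F (f z) (mfderiv 𝓘(ℝ, ℂ) (𝓡 4) f z (1 : ℂ)) *
              (Δ (fun w => F (f w) (mfderiv 𝓘(ℝ, ℂ) (𝓡 4) f w (1 : ℂ)))) z -
            ((fderiv ℝ (fun w => F (f w) (mfderiv 𝓘(ℝ, ℂ) (𝓡 4) f w (1 : ℂ))) z 1) ^ 2 +
              (fderiv ℝ (fun w => F (f w) (mfderiv 𝓘(ℝ, ℂ) (𝓡 4) f w (1 : ℂ))) z Complex.I) ^ 2)) := by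
  obtain ⟨ε, hε, hagree⟩ := hagree
  -- a closed chart-ball inside the chart target
  obtain ⟨r, hr, hball⟩ : ∃ r > (0 : ℝ),
      Metric.closedBall (extChartAt (𝓡 4) p p) r ⊆ (extChartAt (𝓡 4) p).target := by
    obtain ⟨r, hr, h⟩ := Metric.isOpen_iff.mp (isOpen_extChartAt_target (I := 𝓡 4) p)
      (extChartAt (𝓡 4) p p) (mem_extChartAt_target (I := 𝓡 4) p)
    exact ⟨r / 2, half_pos hr, (Metric.closedBall_subset_ball (half_lt_self hr)).trans h⟩
  set ε' : ℝ := min ε r with hε'_def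
  have hε' : 0 < ε' := lt_min hε hr
  -- the coframe `Ψ = dΦ` and `J = Ψ⁻¹ J₀ Ψ`
  set Ψ : punctured p → EuclideanSpace ℝ (Fin 4) →L[ℝ] EuclideanSpace ℝ (Fin 4) :=
    fun x => mfderiv (𝓡 4) 𝓘(ℝ, EuclideanSpace ℝ (Fin 4)) Φ x with hΨ_def
  have hinv : ∀ x, (Ψ x).IsInvertible := fun x =>
    ⟨Φ.mfderivToContinuousLinearEquiv (by simp) x, Φ.mfderivToContinuousLinearEquiv_coe (by simp)⟩
  have hΨs : ∀ x₀ : punctured p, ContMDiffAt (𝓡 4)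
      𝓘(ℝ, EuclideanSpace ℝ (Fin 4) →L[ℝ] EuclideanSpace ℝ (Fin 4)) ∞
      (inTangentCoordinates (𝓡 4) 𝓘(ℝ, EuclideanSpace ℝ (Fin 4)) (id : punctured p → punctured p)
        Φ Ψ x₀) x₀ :=
    fun x₀ => ContMDiffAt.mfderiv_const (Φ.contMDiff x₀) (by simp)
  set J : punctured p → EuclideanSpace ℝ (Fin 4) →L[ℝ] EuclideanSpace ℝ (Fin 4) :=
    fun x => (Ψ x).inverse ∘L stdComplexStructure ∘L Ψ x with hJ_def
  -- the compact core and the radius `R`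
  have hK : IsCompact {x : punctured p | ¬ InPuncturedChartBall p ε' x} :=
    isCompact_setOf_not_inPuncturedChartBall p hε'
  obtain ⟨R₀, hR₀⟩ : ∃ R₀ : ℝ, ∀ x : punctured p, ¬ InPuncturedChartBall p ε' x → ‖Φ x‖ ≤ R₀ := by
    obtain ⟨R₀, hR₀⟩ := (hK.image Φ.continuous).isBounded.exists_norm_le
    exact ⟨R₀, fun x hx => hR₀ _ ⟨x, hx, rfl⟩⟩
  set R : ℝ := max R₀ 0 + 1 with hR_def
  have hR : 0 < R := by positivity
  have hRlt : ∀ x : punctured p, ¬ InPuncturedChartBall p ε' x → ‖Φ x‖ < R := fun x hx =>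
    (hR₀ x hx).trans_lt ((le_max_left _ _).trans_lt (lt_add_one _))
  -- the density
  set F : ∀ x : punctured p, TangentSpace (𝓡 4) x → ℝ :=
    fun x v => ‖Ψ x v‖ ^ 2 / (R ^ 2 - ‖Φ x‖ ^ 2) with hF_def
  refine ⟨fun x => J x, ε', 2, F, hε',
    (Metric.closedBall_subset_closedBall (min_le_right ε r)).trans hball,
    fun x v => conj_conj stdComplexStructure_sq (hinv x) v,
    fun x₀ => contMDiffAt_inTangentCoordinates_conj stdComplexStructure Ψ Φ (hΨs x₀) (hinv x₀),
    ?_, two_pos, ?_, ?_⟩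
  · -- standard on the punctured ball: there `Φ` is the inverted chart, so `dΦ_x = Dι ∘ De_x`
    intro x hx v b
    have hev : (Φ : punctured p → EuclideanSpace ℝ (Fin 4)) =ᶠ[𝓝 x]
        fun z : punctured p => inversion (extChartAt (𝓡 4) p z.1 - extChartAt (𝓡 4) p p) :=
      Filter.eventuallyEq_of_mem ((isOpen_setOf_inPuncturedChartBall p ε').mem_nhds hx)
        fun z hz => hagree z hz.1 (Metric.ball_subset_ball (min_le_left ε r) hz.2)
    have hA : Ψ x = (fderiv ℝ inversion (extChartAt (𝓡 4) p x.1 - extChartAt (𝓡 4) p p)).comp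
        (mfderiv (𝓡 4) 𝓘(ℝ, EuclideanSpace ℝ (Fin 4))
          (fun z : punctured p => extChartAt (𝓡 4) p z.1) x) :=
      ((hasMFDerivAt_inversion_extChartAt_sub p x hx.1).congr_of_eventuallyEq hev).mfderiv
    have hAw : ∀ w : EuclideanSpace ℝ (Fin 4),
        fderiv ℝ inversion (extChartAt (𝓡 4) p x.1 - extChartAt (𝓡 4) p p)
          (mfderiv (𝓡 4) 𝓘(ℝ, EuclideanSpace ℝ (Fin 4))
            (fun z : punctured p => extChartAt (𝓡 4) p z.1) x w) = Ψ x w :=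
      fun w => by rw [hA]; rfl
    simp only [hAw]
    erw [apply_conj (hinv x) v]
    rw [inner_stdComplexStructure_eq_stdSymplecticForm]
  · -- `F` is positive definite off the ball
    intro x hx v
    have hden : 0 < R ^ 2 - ‖Φ x‖ ^ 2 := by
      have h1 : ‖Φ x‖ < R := hRlt x hx
      have h2 : 0 ≤ ‖Φ x‖ := norm_nonneg _
      nlinarith
    refine ⟨div_nonneg (sq_nonneg _) hden.le, fun h0 => ?_⟩
    have h1 : ‖Ψ x v‖ ^ 2 = 0 := by
      rcases (div_eq_zero_iff.mp h0) with h | h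
      · exact h
      · exact absurd h hden.ne'
    have h2 : Ψ x v = 0 := by simpa using h1
    obtain ⟨e, he⟩ := hinv x
    have h3 : e v = 0 := by rw [← he] at h2; exact h2
    have h4 := congrArg e.symm h3
    simp only [ContinuousLinearEquiv.symm_apply_apply, map_zero] at h4
    exact h4
  · -- the curve clause: transfer the model certificate along `Φ`
    intro U f hU hf hhol havoid
    set g : ℂ → EuclideanSpace ℝ (Fin 4) := fun z => Φ (f z) with hg_def
    -- `g` is smooth on `U`
    have hgU : ContMDiffOn 𝓘(ℝ, ℂ) 𝓘(ℝ, EuclideanSpace ℝ (Fin 4)) ∞ g U :=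
      Φ.contMDiff.comp_contMDiffOn hf
    have hg : ContDiffOn ℝ ∞ g U := contMDiffOn_iff_contDiffOn.mp hgU
    -- chain rule on `U`
    have hchain : ∀ z ∈ U, ∀ ζ : ℂ,
        fderiv ℝ g z ζ = Ψ (f z) (mfderiv 𝓘(ℝ, ℂ) (𝓡 4) f z ζ) := by
      intro z hz ζ
      have hfz : MDifferentiableAt 𝓘(ℝ, ℂ) (𝓡 4) f z :=
        ((hf z hz).contMDiffAt (hU.mem_nhds hz)).mdifferentiableAt (by simp)
      have hΦz : MDifferentiableAt (𝓡 4) 𝓘(ℝ, EuclideanSpace ℝ (Fin 4)) Φ (f z) :=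
        Φ.contMDiff.mdifferentiableAt (by simp)
      have h := mfderiv_comp z hΦz hfz
      rw [← mfderiv_eq_fderiv]
      exact congrArg (fun L : ℂ →L[ℝ] EuclideanSpace ℝ (Fin 4) => L ζ) h
    -- `g` is `J₀`-holomorphic on `U`
    have hholg : ∀ z ∈ U, ∀ ζ : ℂ,
        fderiv ℝ g z (Complex.I * ζ) = stdComplexStructure (fderiv ℝ g z ζ) := by
      intro z hz ζ
      rw [hchain z hz, hchain z hz, hhol z hz ζ]
      exact apply_conj (hinv (f z)) _
    -- `g` maps `U` into the ball `B_R`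
    have hbound : ∀ z ∈ U, ‖g z‖ < R := fun z hz => hRlt (f z) (havoid z hz)
    obtain ⟨hC2, hineq⟩ := hM R U g hR hU hg hholg hbound
    -- the two densities agree on `U`
    have heqOn : EqOn (fun w => F (f w) (mfderiv 𝓘(ℝ, ℂ) (𝓡 4) f w (1 : ℂ)))
        (fun w => ‖fderiv ℝ g w 1‖ ^ 2 / (R ^ 2 - ‖g w‖ ^ 2)) U := by
      intro w hw
      simp only [hF_def, hg_def]
      rw [hchain w hw]
    refine ⟨hC2.congr heqOn, fun z hz => ?_⟩
    have hev : (fun w => F (f w) (mfderiv 𝓘(ℝ, ℂ) (𝓡 4) f w (1 : ℂ))) =ᶠ[𝓝 z]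
        (fun w => ‖fderiv ℝ g w 1‖ ^ 2 / (R ^ 2 - ‖g w‖ ^ 2)) :=
      Filter.eventuallyEq_of_mem (hU.mem_nhds hz) heqOn
    have h0 : F (f z) (mfderiv 𝓘(ℝ, ℂ) (𝓡 4) f z (1 : ℂ)) =
        ‖fderiv ℝ g z 1‖ ^ 2 / (R ^ 2 - ‖g z‖ ^ 2) := heqOn hz
    have hlap : (Δ (fun w => F (f w) (mfderiv 𝓘(ℝ, ℂ) (𝓡 4) f w (1 : ℂ)))) z =
        (Δ (fun w => ‖fderiv ℝ g w 1‖ ^ 2 / (R ^ 2 - ‖g w‖ ^ 2))) z :=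
      (InnerProductSpace.laplacian_congr_nhds hev).eq_of_nhds
    have hfd : fderiv ℝ (fun w => F (f w) (mfderiv 𝓘(ℝ, ℂ) (𝓡 4) f w (1 : ℂ))) z =
        fderiv ℝ (fun w => ‖fderiv ℝ g w 1‖ ^ 2 / (R ^ 2 - ‖g w‖ ^ 2)) z := hev.fderiv_eq
    have key := hineq z hz
    rw [← h0, ← hlap, ← hfd] at key
    exact key

/-- **The hyperbolic pair of a homotopy `4`-sphere diffeomorphic to `S⁴`** (the standard case of
`stub_hyperbolicPair`, given the flat model certificate): Palais' chart form
(`palais_puncturedSphere_chartForm_holds`, proved in the tree) supplies `Φ : Σ ∖ p ≃ₘ ℝ⁴`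
agreeing with the inverted chart near `p`. -/
theorem hyperbolicPair_of_nonempty_diffeomorph_sphere :
    (∀ (R : ℝ) (U : Set ℂ) (g : ℂ → EuclideanSpace ℝ (Fin 4)), 0 < R → IsOpen U →
      ContDiffOn ℝ ∞ g U →
      (∀ z ∈ U, ∀ ζ : ℂ, fderiv ℝ g z (Complex.I * ζ) = stdComplexStructure (fderiv ℝ g z ζ)) →
      (∀ z ∈ U, ‖g z‖ < R) →
      ContDiffOn ℝ 2 (fun z => ‖fderiv ℝ g z 1‖ ^ 2 / (R ^ 2 - ‖g z‖ ^ 2)) U ∧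
      ∀ z ∈ U, 2 * 2 * (‖fderiv ℝ g z 1‖ ^ 2 / (R ^ 2 - ‖g z‖ ^ 2)) ^ 3 ≤
        ‖fderiv ℝ g z 1‖ ^ 2 / (R ^ 2 - ‖g z‖ ^ 2) *
            (Δ (fun w => ‖fderiv ℝ g w 1‖ ^ 2 / (R ^ 2 - ‖g w‖ ^ 2))) z -
          ((fderiv ℝ (fun w => ‖fderiv ℝ g w 1‖ ^ 2 / (R ^ 2 - ‖g w‖ ^ 2)) z 1) ^ 2 +
            (fderiv ℝ (fun w => ‖fderiv ℝ g w 1‖ ^ 2 / (R ^ 2 - ‖g w‖ ^ 2)) z Complex.I) ^ 2)) →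
    ∀ (S : HomotopySphere 4) (p : S.carrier),
      Nonempty (S.carrier ≃ₘ⟮𝓡 4, 𝓡 4⟯ Metric.sphere (0 : EuclideanSpace ℝ (Fin 5)) 1) →
    ∃ (J : ∀ x : ↥(punctured p), TangentSpace (𝓡 4) x →L[ℝ] TangentSpace (𝓡 4) x) (ε' c : ℝ)
      (F : ∀ x : ↥(punctured p), TangentSpace (𝓡 4) x → ℝ),
      0 < ε' ∧ Metric.closedBall (extChartAt (𝓡 4) p p) ε' ⊆ (extChartAt (𝓡 4) p).target ∧
      (∀ (x : ↥(punctured p)) (v : TangentSpace (𝓡 4) x), J x (J x v) = -v) ∧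
      (∀ x₀ : ↥(punctured p), ContMDiffAt (𝓡 4)
        𝓘(ℝ, EuclideanSpace ℝ (Fin 4) →L[ℝ] EuclideanSpace ℝ (Fin 4)) ∞
        (inTangentCoordinates (𝓡 4) (𝓡 4) (id : ↥(punctured p) → ↥(punctured p)) id
          (fun x => J x) x₀) x₀) ∧
      (∀ x : ↥(punctured p), InPuncturedChartBall p ε' x →
        ∀ (v : TangentSpace (𝓡 4) x) (b : EuclideanSpace ℝ (Fin 4)),
          inner ℝ (fderiv ℝ inversion (extChartAt (𝓡 4) p x.1 - extChartAt (𝓡 4) p p)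
            (mfderiv (𝓡 4) 𝓘(ℝ, EuclideanSpace ℝ (Fin 4))
              (fun z : ↥(punctured p) => extChartAt (𝓡 4) p z.1) x (J x v))) b =
          stdSymplecticForm (fderiv ℝ inversion (extChartAt (𝓡 4) p x.1 - extChartAt (𝓡 4) p p)
            (mfderiv (𝓡 4) 𝓘(ℝ, EuclideanSpace ℝ (Fin 4))
              (fun z : ↥(punctured p) => extChartAt (𝓡 4) p z.1) x v)) b) ∧
      0 < c ∧
      (∀ x : ↥(punctured p), ¬ InPuncturedChartBall p ε' x →
        ∀ v : TangentSpace (𝓡 4) x, 0 ≤ F x v ∧ (F x v = 0 → v = 0)) ∧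
      (∀ (U : Set ℂ) (f : ℂ → ↥(punctured p)), IsOpen U →
        ContMDiffOn 𝓘(ℝ, ℂ) (𝓡 4) ∞ f U →
        (∀ z ∈ U, ∀ ζ : ℂ, mfderiv 𝓘(ℝ, ℂ) (𝓡 4) f z (Complex.I * ζ : ℂ) =
          J (f z) (mfderiv 𝓘(ℝ, ℂ) (𝓡 4) f z (ζ : ℂ))) →
        (∀ z ∈ U, ¬ InPuncturedChartBall p ε' (f z)) →
        ContDiffOn ℝ 2 (fun z => F (f z) (mfderiv 𝓘(ℝ, ℂ) (𝓡 4) f z (1 : ℂ))) U ∧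
        ∀ z ∈ U, 2 * c * (F (f z) (mfderiv 𝓘(ℝ, ℂ) (𝓡 4) f z (1 : ℂ))) ^ 3 ≤
          F (f z) (mfderiv 𝓘(ℝ, ℂ) (𝓡 4) f z (1 : ℂ)) *
              (Δ (fun w => F (f w) (mfderiv 𝓘(ℝ, ℂ) (𝓡 4) f w (1 : ℂ)))) z -
            ((fderiv ℝ (fun w => F (f w) (mfderiv 𝓘(ℝ, ℂ) (𝓡 4) f w (1 : ℂ))) z 1) ^ 2 +
              (fderiv ℝ (fun w => F (f w) (mfderiv 𝓘(ℝ, ℂ) (𝓡 4) f w (1 : ℂ))) z Complex.I) ^ 2)) := by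
  intro hM S p hS
  obtain ⟨Φ, hΦ⟩ := palais_puncturedSphere_chartForm_holds S.carrier p hS
  exact hyperbolicPair_of_diffeomorph hM p Φ hΦ

end Summit.SmoothPoincare4.SmoothPoincare4.Cruxes.HyperbolicEnd.Sketch

end
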